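import Mathlib
import HarnessLib
import HarnessLib.Audit
import Summits.MatrixMultiplication.Statement
import Literature.Computability.AlgebraicComplexity.SchoenhageTau
import Literature.Computability.AlgebraicComplexity.ArithCircuit
import Literature.Computability.AlgebraicComplexity.MatrixMultiplicationExponent
import Literature.Computability.AlgebraicComplexity.SchoenhageTauBini
import Literature.Computability.AlgebraicComplexity.FlatteningBound
import Literature.Computability.AlgebraicComplexity.StandardFamilies
import HarnessLib.Audit.Status.Attr

/-!
Route: DeterminantalIdealExponent

DORMANT since 2026-08-24T13:30:38Z (reconciler: no traction for 6.8 d (last activity item-evidence-added at 2026-08-17T17:31:06Z); parked, not closed — `ledger route dormant route-MatrixMultiplication-DeterminantalIdealExponent --off` t) — unstaffed, not closed; items shared with open routes are served there. `ledger route dormant <id> --off` reactivates.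

# Route DeterminantalIdealExponent — the determinantal ideal knows omega — omega = 2 iff
quasi-quadratic division-free circuits vanish on the singular matrices; omega > 2 iff (Y,Z) -> YZ is
a hitting-set generator above r^2

Let c(r) be the least size of a division-free fan-in-two circuit (the tree's `complexity`) computing
a NONZERO multiple
g·det_r of the generic r × r determinant — equivalently (DeterminantDivides, in tree) a nonzero
polynomial vanishing on all
singular r × r complex matrices, i.e. a polynomial NOT hit by the product generator (Y,Z) ↦ YZ, Y ∈
ℂ^{r×(r−1)}, Z ∈ ℂ^{(r−1)×r}.
Andrews' lifting (Andrews2022 Thm 3: border multiplicative complexity of every nonzero f in the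
determinantal ideal is
≥ bR(⟨⌊r/4⌋⟩)/6) and the converse calibration c(r) ≤ C_ε r^{ω+ε} (pivot-accumulating block
elimination / BCS Thm 16.7 +
Strassen 1973) give log c(r)/log r → ω: the ideal exponent IS ω. It therefore suffices to show X =
CheapIdealMember: for every
ε > 0 there are arbitrarily large r and a nonzero g with complexity(g·det_r) ≤ r^{2+ε} (any degree,
any sharing, any cofactor).
The negation side is filed in the same currency: HittingThreshold (∃δ>0: eventually every nonzero
multiple of det_r costs
≥ r^{2+δ}, i.e. YZ is a hitting-set generator against size r^{2+δ}) is equivalent to ω > 2 and kills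
X and the summit.
Card realised: determinantal-ideal-lifting-division-free-omega (faces (2) hitting threshold, (3)
cheap ideal member, and the
division-free Cramer export of face (1)).
Lean: `∀ ε : ℝ, 0 < ε → ∃ᶠ r : ℕ in Filter.atTop, ∃ g : MvPolynomial (Fin r × Fin r) ℂ, g ≠ 0 ∧
(Literature.Computability.AlgebraicComplexity.complexity (g *
Literature.Computability.AlgebraicComplexity.detPoly (Fin r) ℂ) : ℝ) ≤ (r : ℝ) ^ (2 + ε)`

## Assembly
Given AndrewsLifting and CheapIdealMember: for each ε > 0 there are arbitrarily large r and g ≠ 0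
with
bR(⟨q,q,q⟩) ≤ 6·complexity(g·det_r) ≤ 6 r^{2+ε}, q = ⌊r/4⌋. Bini's theorem in its discharged cubic
form
(Literature.Computability.AlgebraicComplexity.Blaser2013_thm66_holds.cubic: bR(⟨q,q,q⟩) ≤ ρ, q ≥ 2,
ρ ≥ 1 ⇒ ω ≤ log_q ρ) gives
ω(ℂ) ≤ (log 6 + (2+ε) log r)/log⌊r/4⌋, whose limit along the (unbounded) set of good r is 2 + ε;
hence ω ≤ 2 + ε for every ε,
ω ≤ 2, and MatrixMultiplication by matrixMultiplication_iff_omega_le_two (in tree). Standard real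
asymptotics only; the
assembly is provable now with AndrewsLifting as a hypothesis.

Rationale: WHY THIS LINE. Mechanism: Andrews2022 (arXiv:2208.01078, Thm 3 p. 11, via the Andrews–Forbes
straightening Prop. of AndrewsForbes2022 and a
trace-ABP/Baur–Strassen gadget, Lemma 8 + Prop 2) converts ANY nonzero polynomial of the
determinantal ideal computed with s
multiplications into an approximate bilinear algorithm for ⟨⌊r/4⌋,⌊r/4⌋,⌊r/4⌋⟩ with ≤ 6s products,
with constant-factor (hence
exponent-exact) loss and no degree hypothesis; read together with the elementary converse (nonzero
multiples of det_r are
computable division-free in r^{ω+ε} operations) this makes the minimal circuit size of the ideal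
(det_r) — Grochow2020's
"complexity of an ideal" — a new carrier of ω, and Bini's theorem (Blaser2013 Thm 6.6, discharged in
tree) closes the assembly.
Imported areas: algebraic derandomisation / PIT (hardness versus randomness,
KabanetsImpagliazzo2004; hitting sets for the
vanishing ideal of an explicit generator), commutative algebra of determinantal ideals
(straightening law, BrunsVetter1988), and
division-free computational linear algebra (BurgisserClausenShokrollahi1997 Ch. 16, Problems
16.1–16.2 p. 483; Strassen1973).
What it does that existing routes do not: BorderRankLowerBound (the standing refutation line) must
exhibit EQUATIONS of secant
varieties and is capped by the linear-rank-method barrier; here the negative lever is a HITTING-SET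
statement for the oldest
pseudorandom object of linear algebra (a product of two thin matrices) against circuit SIZE, and the
positive lever enlarges the
design space for ω = 2 from decompositions of one tensor to any cheap polynomial, of any degree,
that detects rank deficiency —
with a built-in converse, so nothing is lost. Negatives index: empty for this summit.

RANKED CRUXES. #0 CheapIdealMember (target) — X — for every ε > 0 there are infinitely many r and a
nonzero cofactor g ∈ ℂ[X_r] such that g·det_r has a division-free fan-in-two circuit of size ≤
r^{2+ε} (card face (3): "some cheap polynomial knows rank"; equivalent to ω(ℂ) = 2 given
AndrewsLifting and FastDetMultiple). (why it might fail: it is ω = 2 in another currency: every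
explicit cheap member known (det(LXM), Pf(XJXᵀ), pivot-accumulated block elimination) is a fast-MM
algorithm in disguise and costs r^{ω+o(1)}; HittingThreshold (= ω > 2) refutes it.) [Andrews2022,
Grochow2020, BurgisserClausenShokrollahi1997, KaltofenVillard2005]
#2 AndrewsLifting (crux) — the named fact the mechanism needs, in the tree's division-free
total-complexity currency (square format): for every r and every nonzero g,
algBorderRank(⟨⌊r/4⌋,⌊r/4⌋,⌊r/4⌋⟩) ≤ 6 · complexity(g · det_r) over ℂ — the corollary of Andrews2022
Thm 3 (any nonzero f ∈ I^det_{n,m,r} has border multiplicative complexity ≥ bR(⟨r/4⟩)/6, char 0) for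
f = g·det_r ∈ I_{r,r,r}, since size ≥ number of product gates ≥ border multiplicative complexity
(card: "Literature facts to vendor"; filed FIRST per D-0019 because it is unproved in tree).
[difficulty: XL] (why it might fail: Published with full proof (FOCS'22/SICOMP'24); the risk is
formalisation: bideterminant straightening (AF22 Prop), trace-ABP Lemma 8, Baur–Strassen inside
ArithCircuit, and matching Andrews' F(ε)-border computation with algBorderRank over ℂ[ε] (Alder/Bini
equivalence) — none in tree.) [Andrews2022, AndrewsForbes2022, BaurStrassen1983, Blaser2013,
BrunsVetter1988, arXiv:2511.16492]
#3 HittingThreshold (crux) — the negation lever (card face (2), C2 target): there is δ > 0 such that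
for all large r every nonzero multiple of det_r needs division-free circuits of size ≥ r^{2+δ} —
equivalently the product map (Y,Z) ↦ YZ with inner dimension r−1 is a hitting-set generator for
r²-variate circuits of size < r^{2+δ}. It implies ¬CheapIdealMember outright and
¬MatrixMultiplication via FastDetMultiple (KillLink); conversely ω > 2 implies it via AndrewsLifting
+ Bini (ThresholdIfOmegaGtTwo). Shared in spirit with BorderRankLowerBound.FThesis (equivalent up to
o(1) in the exponent, by Andrews' lifting), but to be attacked with PIT technology. [difficulty:
open-problem] (why it might fail: Equivalent to ω(ℂ) > 2, which most expect to be false; and if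
true, proving it is a superlinear-power size lower bound for an explicit ideal, beyond the
Baur–Strassen Ω(N log d) record; known HSG bootstrapping (AGS18, KST19, DST21) lives in
constant-variate regimes.) [Andrews2022, KabanetsImpagliazzo2004, BaurStrassen1983,
arXiv:1807.06323, doi:10.1145/3188745.3188762, doi:10.1007/s00037-022-00229-2,
DraismaKahleWiersig2023]
#4 SuperlinearIdealBound (crux) — first rung of the hitting ladder (card C2, "r² polylog" rung
stated qualitatively): for every C, for all large r, every nonzero multiple of det_r needs
division-free circuits of size ≥ C·r². every C < 1/2 is trivial (input-reading bound: g·det_r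
depends on all r² variables, a size-s fan-in-two circuit reads ≤ 2s + 1 of them) and Andrews' Cor 1
gives r²/48 − (log₂ r)/6 PRODUCT gates; asking for every C is the first superlinear (in the number
r² of variables) size bound for the ideal (det_r). Implied by HittingThreshold and, through
AndrewsLifting, by stmt BorderRankLowerBound.FSuperlinearExplicitBorderRank (bR(⟨n,n,n⟩)/n² → ∞); it
does not by itself touch ω. [difficulty: open-problem] (why it might fail: False if some nonzero
multiples of det_r admit circuits of size O(r²) — not excluded, since MM itself may have
quadratic-size circuits (rank ≥ 3n² − o(n²) is all we know); otherwise it is the first superlinear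
size lower bound for an explicit VP ideal, which no current technique delivers.) [BaurStrassen1983,
Andrews2022, AndrewsForbes2022, Grochow2020, LandsbergMichalek2018]
#5 HittingBootstrap (crux) — the amplification engine of card C2, as an implication between the two
rungs: if YZ hits every superlinear-size family (SuperlinearIdealBound) then it hits size r^{2+δ}
for some δ > 0 (HittingThreshold). A regime-bridging bootstrapping theorem for hitting sets against
SIZE in the linear-variate, barely-superlinear regime (AGS18 / KST19 bootstrap from
constant-variate, barely-non-trivial hitting sets; Andrews proves the unconditional base s < r²/48
for product gates). [deps: SuperlinearIdealBound, HittingThreshold] [difficulty: open-problem] (why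
it might fail: False in the world "ω = 2 but c(r)/r² → ∞" (e.g. if R(⟨n,n,n⟩) ≍ n² log n); every
known amplification (Kabanets–Impagliazzo, AGS18, KST19) spends variables via NW designs and
destroys the vanishing-ideal structure, and DST21's weak-bound derandomisation is constant-variate.)
[doi:10.1145/3188745.3188762, arXiv:1807.06323, KabanetsImpagliazzo2004,
doi:10.1007/s00037-022-00229-2, Andrews2022]
#9 FastDetMultiple (support) — converse calibration c(r) ≤ C_ε r^{ω+ε}: for every ε > 0 there is C
such that for every r ≥ 1 some NONZERO multiple g·det_r has a division-free circuit of size ≤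
C·r^{ω(ℂ)+ε}. Intended proof (no divisions anywhere): pivot-accumulating block elimination — for X =
[[A,B],[C,D]] with (a, A') = (pseudo-det, pseudo-adjugate) of A (A·A' = a·I), S := a·D − C·A'·B, (s,
S') likewise for S, put P(X) := a·s and Q(X) := [[s·A' + A'BS'CA', −a·A'BS'], [−a·S'CA', a²·S']], so
X·Q = P·I and P is a nonzero multiple of det X; T(r) = 2T(r/2) + O(MM(r/2)) + O(r²); plus the
total-cost form of ω (BCS Prop 15.1 / Blaser2013 Thm 5.2: circuits of size O(n^{ω+ε}) for all
entries of an n × n product, with sharing inside one ArithCircuit). Classical alternative: BCS Thm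
(16.7) (p. 463, with divisions) + Strassen1973 numerator/denominator simulation (factor ≤ 4). Makes
X ⟺ ω = 2 and is the glue of KillLink. [difficulty: L] [BurgisserClausenShokrollahi1997,
Strassen1973, Blaser2013, KaltofenVillard2005]
#9 KillLink (support) — the formal kill switch: FastDetMultiple → HittingThreshold →
¬MatrixMultiplication (if ω = 2, FastDetMultiple with ε = δ/2 gives multiples of size C·r^{2+δ/2} <
r^{2+δ} for large r). Elementary real asymptotics. [difficulty: provable-now] [Blaser2013,
BurgisserClausenShokrollahi1997]
#9 ThresholdIfOmegaGtTwo (support) — the other half of the dichotomy: AndrewsLifting →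
¬MatrixMultiplication → HittingThreshold. If ω > 2 pick 0 < δ < ω − 2; Bini in contrapositive
(Blaser2013_thm66_holds.cubic: bR(⟨m,m,m⟩) ≤ ρ ⇒ ω ≤ log_m ρ, so bR(⟨m,m,m⟩) ≥ m^ω) and
AndrewsLifting give complexity(g·det_r) ≥ ⌊r/4⌋^ω/6 ≥ r^{2+δ} eventually. With KillLink this shows
HittingThreshold ⟺ ω > 2 and CheapIdealMember ⟺ ω = 2 modulo the two facts ("the ideal knows ω").
[difficulty: M] [Blaser2013, Andrews2022]
#9 KernelOfGenericMatrix (support) — card S1 (Hilbert–Burch-lite): over ℂ[X], X the generic r ×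
(r+1) matrix, every polynomial kernel vector y (X·y = 0) is a polynomial multiple of the vector π of
signed maximal minors, π_j = (−1)^j det(X with column j deleted). Proof: π spans the kernel over the
fraction field (rank r, Cramer), so y = (h/k)·π with h, k coprime; the π_j are pairwise
non-associate irreducibles (irreducible_det_of_X, in tree), so k is a unit. Needed for
CramerDenominatorHard. [difficulty: provable-now] [BrunsVetter1988, BurgisserClausenShokrollahi1997]
#9 CramerDenominatorHard (support) — card face (1)(a), division-free total-cost half of BCS Problem
16.1 (p. 483): if polynomials y_1..y_r, d in the entries of a generic (A, b) satisfy A·y = d·b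
identically with d ≠ 0 (a "Cramer-form" solution of the generic linear system), then bR(⟨⌊r/4⌋⟩) ≤
6·complexity(d); hence every division-free straight-line solver in Cramer form costs ≥ ⌊r/4⌋^ω/6,
while the pseudo-adjugate recursion of FastDetMultiple (y := Q(A)·b, d := P(A)) solves in Cramer
form division-free in O(r^{ω+ε}) — the exponent of division-free Cramer-form SLS is exactly ω.
Proof: (y, −d) is a kernel vector of [A | b], so by KernelOfGenericMatrix d = ±h·det(A) with h ≠ 0;
specialise b to constants keeping h ≠ 0 (complexity_aeval_le: substitution of constants is free) and
apply AndrewsLifting. The with-division upgrade (x_1 = (A⁻¹b)_1 has reduced denominator det A, so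
any SLP with divisions has a denominator in (det A): total-cost exponent of SLS = ω) and the
singularity-tree version of Problem 16.2 wait for an SLP-with-division / computation-tree model
(Definition requests). [difficulty: M] [BurgisserClausenShokrollahi1997, Andrews2022, Strassen1973]

TWO-LAYER PLAN. Foreseen glued splits (nothing filed now): AndrewsLifting ⇐
AFStraighteningToPrincipalMinors (AF22 Prop.: a border-linear
substitution sends any nonzero f ∈ (det_r) to ε^q·α·∏ det(X_{[σ_i]}) + O(ε^{q+1}) with σ_1 ≥ r) →
TraceABPOracle (Andrews Lemma 8
+ Prop 2 + Baur–Strassen + Lemma 7: an oracle for such a product yields ⟨⌊r/4⌋⟩ approximately with ≤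
3s products, bR ≤ 6s) →
AndrewsLifting. HittingThreshold ⇐ SuperlinearIdealBound → HittingBootstrap → HittingThreshold (glue
is modus ponens; both
children are already items). CheapIdealMember ⇐ a construction crux from a companion route (e.g. the
hidden-corner thesis of
card structured-determinantal-witnesses-hidden-corner) → its cost lemma → CheapIdealMember, attached
by signature dedup if
that route files the same target.

KILL CRITERIA. HittingThreshold proved (here, or any δ-superquadratic size bound for multiples of
det_r proved anywhere) refutes
CheapIdealMember at once and, through KillLink + FastDetMultiple, the summit: close
`refuted:CheapIdealMember` and hand the
decls to BorderRankLowerBound as its PIT-side engine. BorderRankLowerBound.FThesis proved ⇒ summit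
refuted ⇒ route moot (same
close). A refutation of AndrewsLifting as typed (an error in the square/total-complexity
specialisation) forces a pivot to the
multiplicative-complexity statement (Definition request D1), not a close. ω = 2 proved elsewhere
proves X (via FastDetMultiple)
and refutes cruxes 3–5: close `superseded`. SuperlinearIdealBound refuted (linear-size circuits for
some nonzero multiples of
det_r) kills the hitting ladder but STRENGTHENS the positive side (it exhibits unexpectedly cheap
ideal members): pivot, keep X.

NOT DECOMPOSED YET. General formats n × m ≥ r (the full ideal I^det_{n,m,r} and the literal
YZ-generator phrasing: Andrews' Lemma 4 needs the
radicality of I_r — Hochster–Eagon / BrunsVetter1988 — absent from Mathlib; the square case uses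
det_dvd_of_forall_eval_eq_zero,
in tree); the multiplicative-complexity (C_*) and with-division forms of AndrewsLifting and of the
exports (BCS 16.1 with
divisions in the total-cost model; the singularity-tree half of BCS 16.2 via the generic-path lemma,
card S2) — pending the
definitions below; the border-complexity enlargement of X (approximate circuits over ℂ[ε], covered
by Andrews' theorem, a
strictly larger search space à la Bini); the low-degree classification of cheapest ideal members by
GL×GL isotypic type (card
C3); explicit constants in FastDetMultiple; the AF22 straightening Prop. as a stand-alone Literature
fact.

CHEAPEST FALSIFIER. Lookup, not computation: (i) read the SICOMP 2024 version of Andrews2022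
(doi:10.1137/22m1536169) and Grochow2020 §§ on
determinantal ideals for an erratum to Thm 3 or for the converse/hitting-threshold reading and the
division-free SLS corollary
already in print (kills novelty, not the line); (ii) the line itself dies only with ω: the cheapest
concrete attack on a CRUX is
SuperlinearIdealBound at C = 1 — exhibit nonzero multiples of det_r with circuits of size ≤ r² (e.g.
search r ≤ 4 exhaustively
over circuit skeletons with kit) — a hit would refute crux 4 and embarrass crux 3. Small-r sanity of
AndrewsLifting as typed is
automatic (r < 8: bR(⟨1,1,1⟩) = 1; r = 8: bR(⟨2,2,2⟩) = 7 ≤ 6·32 by the input bound), so no finite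
check can kill crux 2.

NUMBERS. ω(ℂ) < 2.3714 (AlmanEtAl2024 / advxxz2025 in tree); bR(⟨n,n,n⟩) ≥ 2n² − ⌈log₂ n⌉ − 1
(LandsbergMichalek2018), rank methods
capped at 6n² − 4 / 8n² (LinearRankMethodBarrier, EfremenkoGargOliveiraWigderson2018 Thm 4.4);
Andrews2022 Cor 1: border
multiplicative complexity of I^det_{n,m,r} ≥ r²/48 − (log₂ r)/6 + 1/6, Thm 4: YZ hits the closure of
n-variate circuits with
s product gates with seed 8√n·bR⁻¹(6s+1); trivial size bound for multiples of det_r: r²/2 (input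
reading); division-free
determinant: O(n^{2.698}) (KaltofenVillard2005), Berkowitz polynomial bound in tree
(complexity_detPoly_le); with divisions
ω(Det) = ω(LUP) = ω(SLS ≤) (BCS Thm 16.7, Prop 16.6). Items at open: 11 (1 target, 4 cruxes, 5
support, 1 assembly).

DEFINITION REQUESTS. D1 `mulGateCount` / multiplicative (nonscalar) complexity of an MvPolynomial in
the ArithCircuit model (number of product gates
of a fan-in-two circuit; Andrews Def 1, the c_*-length of BurgisserClausenShokrollahi1997 Ch. 4) —
lets AndrewsLifting and CramerDenominatorHard be stated at
published strength (to be filed after open, topic Literature/Computability/AlgebraicComplexity, for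
AndrewsLifting).
D2 straight-line programs WITH division over ℂ(X) executable on a Zariski-open set, and Strassen's
numerator/denominator
simulation (Strassen1973; BCS Ch. 4, §7.1) — needed for BCS Problems 16.1/16.2 verbatim (not filed
now).
D3 border (approximative) circuit complexity over ℂ[ε] (Andrews Def 4; Debordering2025 Def 1.1) —
enlarges X (not filed now).
Cite facts wanted: AndrewsForbes2022 straightening Prop. (border substitution to a product of
principal minors) as a Literature
named fact; BCS Prop 15.1 / Blaser2013 Thm 5.2 (total arithmetic cost exponent = ω) for
FastDetMultiple.

Novelty: Searches (2026-08-15; OpenAlex/S2/arXiv APIs rate-limited, crossref + local + citation graph used):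
`lit search "determinantal
ideal polynomial identity testing border rank matrix multiplication hitting set multiplicative
complexity" --year-from 2022`
(local 1: paper:arxiv-2208.01078; crossref 19, relevant: doi:10.1137/22m1536169 = SICOMP version of
Andrews2022);
`lit citing arxiv:2208.01078` (2: SIGACT News Complexity Column 121, 2024); `lit citing
doi:10.1145/3519935.3520025` (26;
relevant: arXiv:2511.16492 debordering closure results for determinantal/Pfaffian ideals 2025, read
pp. 2–5;
DraismaKahleWiersig2023 doi:10.1112/blms.12819 sparsity of I_r members; arXiv:2306.02184 PIT vs
IPS); `lit frontier
MatrixMultiplication --since 2022` (30 rows, none on ideals/PIT); `lit galaxy search "vanish on all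
matrices of rank" --star
all` (0), `"lower bounds for ideals" --star all` (0), `--star pdf "determinantal ideal"` (20,
commutative algebra only); grep of
the 25 route files of the sub-problem for Andrews|determinantal ideal|hitting|division-free|PIT (0
routes); BCS97 p. 483–485
and Andrews22 pp. 3–12 page-read.
Nearest prior art found: Andrews2022 (Thm 3, Cor 1, Thm 4, Cor 3: the lifting and the
one-directional win-win "ω = 2 or
non-trivial PIT"); AndrewsForbes2022 and arXiv:2511.16492 (closure/reducibility for determinantal
ideals in the border, resp.
exact poly-degree setting, t = Θ(r^{1/3}) — polynomial, not exponent-exact); Grochow2020 (complexity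
of ideals, conjecture for
I  [refs: 10.1137/22m1536169, 10.1145/3519935.3520025`, 10.1112/blms.12819, 2208.01078, 2511.16492, 2306.02184, paper:arxiv-2208.01078, doi:10.1137/22m1536169, arxiv:2208.01078, doi:10.1145/3519935.3520025, doi:10.1112/blms.12819, Andrews2022, AndrewsForbes2022, Grochow2020, BurgisserClausenShokrollahi1997]

Barriers (technique_class: hardness-randomness, determinantal-ideal, PIT): - technique_class: hardness-randomness, determinantal-ideal, PIT
- Literature.Barriers.MatrixMultiplication.LinearRankMethodBarrier: bites only if a proof of
HittingThreshold / SuperlinearIdealBound internally lower-bounds bR(⟨n,n,n⟩) by determinantal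
equations (capped at 6m − 4, never superlinear in m = n²); the line asks instead for circuit-SIZE
lower bounds on the vanishing ideal of the explicit generator YZ (a hitting-set certificate, not an
equation of σ_r); conceded: no technique for such bounds beyond Baur–Strassen exists either — that
is crux 5's bet.
- Literature.Barriers.MatrixMultiplication.InfimumNotMinimumBarrier: compatible — CheapIdealMember
quantifies over infinitely many r with exponent 2 + ε and never asserts a single identity certifying
2; the assembly takes the infimum through Bini.
- Literature.Barriers.MatrixMultiplication.UniversalMethodBarrier: does not apply — no intermediate
tensor is degenerated; a cheap ideal member becomes an MM algorithm through Andrews' oracle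
reduction + Baur–Strassen, outside the Schönhage/laser/universal-method class (same for
IrreversibilityBarrier, RectangularBarrier, UnstableTensorBarrier).
- Literature.Barriers.MatrixMultiplication.NormalizerBarrier: n/a (no group-theoretic embedding;
likewise NilpotentGroupBarrier, QuasirandomBarrier, YoungSubgroupBarrier, TricoloredSumFreeBarrier,
EquivoluminousBarrier).
- Uncatalogued: algebraic natural proofs (ForbesShpilkaVolk2018, arXiv:2004.14147) concern succinct
EQUATIONS for VP-

Novelty grade: variant — route-review (refuter rreview-c9821b09): VARIANT / dictionary route. (1) Target CheapIdealMember ⟺ ω(ℂ)=2 modulo AndrewsLifting (printed, now vendored p42575 as Andrews2022_thm3_square) and FastDetMultiple (TRUE on paper: division-free pseudo-adjugate recursion X·Q = P·I, T(r)=2T(r/2)+O(r^{ω+ε}), P  (refuter refuter-rreview-route-AtomisticToContinu-c9821b09-0, 2026-08-15T13:59:19Z; prior: arXiv:2208.01078 (Andrews2022) Thm 3 + Cor 1 p.11, Cor 3 p.12 (read at page): bR(⟨r/4⟩) ≤ 6s for any nonzero f ∈ I_r; win-win 'ω = 2 OR explicit HSG', BurgisserClausenShokrollahi1997 Thm 16.7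 / Prob 16.1 p.483; Strassen1973 (division removal); Blaser2013 Thm 6.6 (Bini), Grochow2020 (complexity of an ideal); KaltofenVillard2005)

History (route lifecycle, newest last):
- 2026-08-16T04:10:39Z · AUTO-CRUX (backfill): CheapIdealMember — hypotheses of the deciding theorem that nothing in the route derives are cruxes (operator:999:1085951)
- 2026-08-24T13:30:38Z · DORMANT — reconciler: no traction for 6.8 d (last activity item-evidence-added at 2026-08-17T17:31:06Z); parked, not closed — `ledger route dormant route-MatrixMultiplica (operator:999:1014807)

sub-problem: MatrixMultiplication · status: dormant · opened planner-plancard-MatrixMultiplication-MatrixM-a01dec58-0 2026-08-15T12:16:47Z · rev 3 · ledger route-MatrixMultiplication-DeterminantalIdealExponent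
GENERATED by the gate from the ledger (D-0016/17). Provers cite these decls: `theorem foo : Summit.MatrixMultiplication.MatrixMultiplication.Theses.DeterminantalIdealExponent.<Decl> := …` in Summits/MatrixMultiplication/MatrixMultiplication/Theorems/<Name>.lean.
-/

namespace Summit.MatrixMultiplication.MatrixMultiplication.Theses.DeterminantalIdealExponent

open scoped BigOperators Topology Manifold Classical MeasureTheory ProbabilityTheory Matrix InnerProductSpace ComplexConjugate ContinuousMap
open Filter Set Function TopologicalSpace MeasureTheory

attribute [summit_statement] _root_.MatrixMultiplication

/-- item stmt-MatrixMultiplication-7708 · crux (kind.auto-crux: conjecture-grade) · rank 0 · open · by planner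
why it might fail: it is ω = 2 in another currency: every explicit cheap member known (det(LXM), Pf(XJXᵀ), pivot-accumulated block elimination) is a fast-MM algorithm in disguise and costs r^{ω+o(1)}; HittingThreshold (= ω > 2) refutes it.
sources: Andrews2022, Grochow2020, BurgisserClausenShokrollahi1997, KaltofenVillard2005
[target] X — for every ε > 0 there are infinitely many r and a nonzero cofactor g ∈ ℂ[X_r] such that
g·det_r has a division-free fan-in-two circuit of size ≤ r^{2+ε} (card face (3): "some cheap
polynomial knows rank"; equivalent to ω(ℂ) = 2 given AndrewsLifting and FastDetMultiple). -/
@[route_item "route-MatrixMultiplication-DeterminantalIdealExponent", crux]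
def CheapIdealMember : Prop :=
  ∀ ε : ℝ, 0 < ε → ∃ᶠ r : ℕ in Filter.atTop, ∃ g : MvPolynomial (Fin r × Fin r) ℂ, g ≠ 0 ∧ (Literature.Computability.AlgebraicComplexity.complexity (g * Literature.Computability.AlgebraicComplexity.detPoly (Fin r) ℂ) : ℝ) ≤ (r : ℝ) ^ (2 + ε)

/-- item stmt-MatrixMultiplication-7709 · crux · rank 2 · closed · proved by Summit.MatrixMultiplication.MatrixMultiplication.Theorems.determinantalIdealExponent_andrewsLifting @ aa046fa209a8 (planner) · by planner
why it might fail: Published with full proof (FOCS'22/SICOMP'24); the risk is formalisation: bideterminant straightening (AF22 Prop), trace-ABP Lemma 8, Baur–Strassen inside ArithCircuit, and matching Andrews' F(ε)-border computation with algBorderRank over ℂ[ε] (Alder/Bini equivalence) — none in tree.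
sources: Andrews2022, AndrewsForbes2022, BaurStrassen1983, Blaser2013, BrunsVetter1988, arXiv:2511.16492
[crux] the named fact the mechanism needs, in the tree's division-free total-complexity currency
(square format): for every r and every nonzero g, algBorderRank(⟨⌊r/4⌋,⌊r/4⌋,⌊r/4⌋⟩) ≤ 6 ·
complexity(g · det_r) over ℂ — the corollary of Andrews2022 Thm 3 (any nonzero f ∈ I^det_{n,m,r} has
border multiplicative complexity ≥ bR(⟨r/4⟩)/6, char 0) for f = g·det_r ∈ I_{r,r,r}, since size ≥
number of product gates ≥ border multiplicative complexity (card: "Literature facts to vendor";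
filed FIRST per D-0019 because it is unproved in tree). [difficulty: XL] -/
@[route_item "route-MatrixMultiplication-DeterminantalIdealExponent", crux]
def AndrewsLifting : Prop :=
  ∀ (r : ℕ) (g : MvPolynomial (Fin r × Fin r) ℂ), g ≠ 0 → Literature.Computability.AlgebraicComplexity.algBorderRank (Literature.Computability.AlgebraicComplexity.matMulTensor ℂ (r / 4) (r / 4) (r / 4)) ≤ 6 * Literature.Computability.AlgebraicComplexity.complexity (g * Literature.Computability.AlgebraicComplexity.detPoly (Fin r) ℂ)

/-- item stmt-MatrixMultiplication-7710 · crux · rank 3 · open · by planner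
why it might fail: Equivalent to ω(ℂ) > 2, which most expect to be false; and if true, proving it is a superlinear-power size lower bound for an explicit ideal, beyond the Baur–Strassen Ω(N log d) record; known HSG bootstrapping (AGS18, KST19, DST21) lives in constant-variate regimes.
sources: Andrews2022, KabanetsImpagliazzo2004, BaurStrassen1983, arXiv:1807.06323, doi:10.1145/3188745.3188762, doi:10.1007/s00037-022-00229-2
[crux] the negation lever (card face (2), C2 target): there is δ > 0 such that for all large r every
nonzero multiple of det_r needs division-free circuits of size ≥ r^{2+δ} — equivalently the product
map (Y,Z) ↦ YZ with inner dimension r−1 is a hitting-set generator for r²-variate circuits of size <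
r^{2+δ}. It implies ¬CheapIdealMember outright and ¬MatrixMultiplication via FastDetMultiple
(KillLink); conversely ω > 2 implies it via AndrewsLifting + Bini (ThresholdIfOmegaGtTwo). Shared in
spirit with BorderRankLowerBound.FThesis (equivalent up to o(1) in the exponent, by Andrews'
lifting), but to be attacked with PIT technology. [difficulty: open-problem] -/
@[route_item "route-MatrixMultiplication-DeterminantalIdealExponent"]
def HittingThreshold : Prop :=
  ∃ δ : ℝ, 0 < δ ∧ ∀ᶠ r : ℕ in Filter.atTop, ∀ g : MvPolynomial (Fin r × Fin r) ℂ, g ≠ 0 → (r : ℝ) ^ (2 + δ) ≤ (Literature.Computability.AlgebraicComplexity.complexity (g * Literature.Computability.AlgebraicComplexity.detPoly (Fin r) ℂ) : ℝ)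

/-- item stmt-MatrixMultiplication-7711 · crux · rank 4 · open · by planner
why it might fail: False if some nonzero multiples of det_r admit circuits of size O(r²) — not excluded, since MM itself may have quadratic-size circuits (rank ≥ 3n² − o(n²) is all we know); otherwise it is the first superlinear size lower bound for an explicit VP ideal, which no current technique delivers.
sources: BaurStrassen1983, Andrews2022, AndrewsForbes2022, Grochow2020, LandsbergMichalek2018
[crux] first rung of the hitting ladder (card C2, "r² polylog" rung stated qualitatively): for every
C, for all large r, every nonzero multiple of det_r needs division-free circuits of size ≥ C·r².
every C < 1/2 is trivial (input-reading bound: g·det_r depends on all r² variables, a size-s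
fan-in-two circuit reads ≤ 2s + 1 of them) and Andrews' Cor 1 gives r²/48 − (log₂ r)/6 PRODUCT
gates; asking for every C is the first superlinear (in the number r² of variables) size bound for
the ideal (det_r). Implied by HittingThreshold and, through AndrewsLifting, by stmt
BorderRankLowerBound.FSuperlinearExplicitBorderRank (bR(⟨n,n,n⟩)/n² → ∞); it does not by itself
touch ω. [difficulty: open-problem] -/
@[route_item "route-MatrixMultiplication-DeterminantalIdealExponent"]
def SuperlinearIdealBound : Prop :=
  ∀ C : ℝ, ∀ᶠ r : ℕ in Filter.atTop, ∀ g : MvPolynomial (Fin r × Fin r) ℂ, g ≠ 0 → C * (r : ℝ) ^ 2 ≤ (Literature.Computability.AlgebraicComplexity.complexity (g * Literature.Computability.AlgebraicComplexity.detPoly (Fin r) ℂ) : ℝ)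

/-- item stmt-MatrixMultiplication-7712 · crux · rank 5 · open · by planner
why it might fail: False in the world "ω = 2 but c(r)/r² → ∞" (e.g. if R(⟨n,n,n⟩) ≍ n² log n); every known amplification (Kabanets–Impagliazzo, AGS18, KST19) spends variables via NW designs and destroys the vanishing-ideal structure, and DST21's weak-bound derandomisation is constant-variate.
sources: doi:10.1145/3188745.3188762, arXiv:1807.06323, KabanetsImpagliazzo2004, doi:10.1007/s00037-022-00229-2, Andrews2022
[crux] the amplification engine of card C2, as an implication between the two rungs: if YZ hits
every superlinear-size family (SuperlinearIdealBound) then it hits size r^{2+δ} for some δ > 0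
(HittingThreshold). A regime-bridging bootstrapping theorem for hitting sets against SIZE in the
linear-variate, barely-superlinear regime (AGS18 / KST19 bootstrap from constant-variate,
barely-non-trivial hitting sets; Andrews proves the unconditional base s < r²/48 for product gates).
[deps: SuperlinearIdealBound, HittingThreshold] [difficulty: open-problem] -/
@[route_item "route-MatrixMultiplication-DeterminantalIdealExponent"]
def HittingBootstrap : Prop :=
  (∀ C : ℝ, ∀ᶠ r : ℕ in Filter.atTop, ∀ g : MvPolynomial (Fin r × Fin r) ℂ, g ≠ 0 → C * (r : ℝ) ^ 2 ≤ (Literature.Computability.AlgebraicComplexity.complexity (g * Literature.Computability.AlgebraicComplexity.detPoly (Fin r) ℂ) : ℝ)) → ∃ δ : ℝ, 0 < δ ∧ ∀ᶠ r : ℕ in Filter.atTop, ∀ g : MvPolynomial (Fin r × Fin r) ℂ, g ≠ 0 → (r : ℝ) ^ (2 + δ) ≤ (Literature.Computability.AlgebraicComplexity.complexity (g * Literature.Computability.AlgebraicComplexity.detPoly (Fin r) ℂ) : ℝ)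

/-- item stmt-MatrixMultiplication-7713 · support · rank 9 · open · by planner
sources: BurgisserClausenShokrollahi1997, Strassen1973, Blaser2013, KaltofenVillard2005
[support] converse calibration c(r) ≤ C_ε r^{ω+ε}: for every ε > 0 there is C such that for every r
≥ 1 some NONZERO multiple g·det_r has a division-free circuit of size ≤ C·r^{ω(ℂ)+ε}. Intended proof
(no divisions anywhere): pivot-accumulating block elimination — for X = [[A,B],[C,D]] with (a, A') =
(pseudo-det, pseudo-adjugate) of A (A·A' = a·I), S := a·D − C·A'·B, (s, S') likewise for S, put P(X)
:= a·s and Q(X) := [[s·A' + A'BS'CA', −a·A'BS'], [−a·S'CA', a²·S']], so X·Q = P·I and P is a nonzero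
multiple of det X; T(r) = 2T(r/2) + O(MM(r/2)) + O(r²); plus the total-cost form of ω (BCS Prop 15.1
/ Blaser2013 Thm 5.2: circuits of size O(n^{ω+ε}) for all entries of an n × n product, with sharing
inside one ArithCircuit). Classical alternative: BCS Thm (16.7) (p. 463, with divisions) +
Strassen1973 numerator/denominator simulation (factor ≤ 4). Makes X ⟺ ω = 2 and is the glue of
KillLink. [difficulty: L] -/
@[route_item "route-MatrixMultiplication-DeterminantalIdealExponent", crux]
def FastDetMultiple : Prop :=
  ∀ ε : ℝ, 0 < ε → ∃ C : ℝ, ∀ r : ℕ, 1 ≤ r → ∃ g : MvPolynomial (Fin r × Fin r) ℂ, g ≠ 0 ∧ (Literature.Computability.AlgebraicComplexity.complexity (g * Literature.Computability.AlgebraicComplexity.detPoly (Fin r) ℂ) : ℝ) ≤ C * (r : ℝ) ^ (Literature.Computability.AlgebraicComplexity.omega ℂ + ε)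

/-- item stmt-MatrixMultiplication-7714 · support · rank 9 · open · by planner
sources: Blaser2013, BurgisserClausenShokrollahi1997
[support] the formal kill switch: FastDetMultiple → HittingThreshold → ¬MatrixMultiplication (if ω =
2, FastDetMultiple with ε = δ/2 gives multiples of size C·r^{2+δ/2} < r^{2+δ} for large r).
Elementary real asymptotics. [difficulty: provable-now] -/
@[route_item "route-MatrixMultiplication-DeterminantalIdealExponent"]
def KillLink : Prop :=
  (∀ ε : ℝ, 0 < ε → ∃ C : ℝ, ∀ r : ℕ, 1 ≤ r → ∃ g : MvPolynomial (Fin r × Fin r) ℂ, g ≠ 0 ∧ (Literature.Computability.AlgebraicComplexity.complexity (g * Literature.Computability.AlgebraicComplexity.detPoly (Fin r) ℂ) : ℝ) ≤ C * (r : ℝ) ^ (Literature.Computability.AlgebraicComplexity.omega ℂ + ε)) → (∃ δ : ℝ, 0 < δ ∧ ∀ᶠ r : ℕ in Filter.atTop, ∀ g : MvPolynomial (Fin r × Fin r) ℂ, g ≠ 0 → (r : ℝ) ^ (2 + δ) ≤ (Literature.Computability.AlgebraicComplexity.complexity (g * Literature.Computability.AlgebraicComplexity.detPoly (Fin r) ℂ)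 : ℝ)) → ¬ MatrixMultiplication

/-- item stmt-MatrixMultiplication-7715 · support · rank 9 · open · by planner
sources: Blaser2013, Andrews2022
[support] the other half of the dichotomy: AndrewsLifting → ¬MatrixMultiplication →
HittingThreshold. If ω > 2 pick 0 < δ < ω − 2; Bini in contrapositive (Blaser2013_thm66_holds.cubic:
bR(⟨m,m,m⟩) ≤ ρ ⇒ ω ≤ log_m ρ, so bR(⟨m,m,m⟩) ≥ m^ω) and AndrewsLifting give complexity(g·det_r) ≥
⌊r/4⌋^ω/6 ≥ r^{2+δ} eventually. With KillLink this shows HittingThreshold ⟺ ω > 2 and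
CheapIdealMember ⟺ ω = 2 modulo the two facts ("the ideal knows ω"). [difficulty: M] -/
@[route_item "route-MatrixMultiplication-DeterminantalIdealExponent"]
def ThresholdIfOmegaGtTwo : Prop :=
  (∀ (r : ℕ) (g : MvPolynomial (Fin r × Fin r) ℂ), g ≠ 0 → Literature.Computability.AlgebraicComplexity.algBorderRank (Literature.Computability.AlgebraicComplexity.matMulTensor ℂ (r / 4) (r / 4) (r / 4)) ≤ 6 * Literature.Computability.AlgebraicComplexity.complexity (g * Literature.Computability.AlgebraicComplexity.detPoly (Fin r) ℂ)) → ¬ MatrixMultiplication → ∃ δ : ℝ, 0 < δ ∧ ∀ᶠ r : ℕ in Filter.atTop, ∀ g : MvPolynomial (Fin r × Fin r) ℂ, g ≠ 0 → (r : ℝ) ^ (2 + δ) ≤ (Literature.Computability.AlgebraicComplexity.complexity (g * Literature.Computability.AlgebraicComplexity.detPoly (Fin r) ℂ) : ℝ)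

/-- item stmt-MatrixMultiplication-7716 · support · rank 9 · open · by planner
sources: BrunsVetter1988, BurgisserClausenShokrollahi1997
[support] card S1 (Hilbert–Burch-lite): over ℂ[X], X the generic r × (r+1) matrix, every polynomial
kernel vector y (X·y = 0) is a polynomial multiple of the vector π of signed maximal minors, π_j =
(−1)^j det(X with column j deleted). Proof: π spans the kernel over the fraction field (rank r,
Cramer), so y = (h/k)·π with h, k coprime; the π_j are pairwise non-associate irreducibles
(irreducible_det_of_X, in tree), so k is a unit. Needed for CramerDenominatorHard. [difficulty:
provable-now] -/
@[route_item "route-MatrixMultiplication-DeterminantalIdealExponent"]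
def KernelOfGenericMatrix : Prop :=
  ∀ (r : ℕ) (y : Fin (r + 1) → MvPolynomial (Fin r × Fin (r + 1)) ℂ), (Matrix.mvPolynomialX (Fin r) (Fin (r + 1)) ℂ).mulVec y = 0 → ∃ h : MvPolynomial (Fin r × Fin (r + 1)) ℂ, ∀ j : Fin (r + 1), y j = h * ((-1 : MvPolynomial (Fin r × Fin (r + 1)) ℂ) ^ (j : ℕ) * ((Matrix.mvPolynomialX (Fin r) (Fin (r + 1)) ℂ).submatrix id (Fin.succAbove j)).det)

/-- item stmt-MatrixMultiplication-7717 · support · rank 9 · open · by planner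
sources: BurgisserClausenShokrollahi1997, Andrews2022, Strassen1973
[support] card face (1)(a), division-free total-cost half of BCS Problem 16.1 (p. 483): if
polynomials y_1..y_r, d in the entries of a generic (A, b) satisfy A·y = d·b identically with d ≠ 0
(a "Cramer-form" solution of the generic linear system), then bR(⟨⌊r/4⌋⟩) ≤ 6·complexity(d); hence
every division-free straight-line solver in Cramer form costs ≥ ⌊r/4⌋^ω/6, while the pseudo-adjugate
recursion of FastDetMultiple (y := Q(A)·b, d := P(A)) solves in Cramer form division-free in
O(r^{ω+ε}) — the exponent of division-free Cramer-form SLS is exactly ω. Proof: (y, −d) is a kernel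
vector of [A | b], so by KernelOfGenericMatrix d = ±h·det(A) with h ≠ 0; specialise b to constants
keeping h ≠ 0 (complexity_aeval_le: substitution of constants is free) and apply AndrewsLifting. The
with-division upgrade (x_1 = (A⁻¹b)_1 has reduced denominator det A, so any SLP with divisions has a
denominator in (det A): total-cost exponent of SLS = ω) and the singularity-tree version of Problem
16.2 wait for an SLP-with-division / computation-tree model (Definition requests). [difficulty: M] -/
@[route_item "route-MatrixMultiplication-DeterminantalIdealExponent"]
def CramerDenominatorHard : Prop :=
  ∀ (r : ℕ) (y : Fin r → MvPolynomial ((Fin r × Fin r) ⊕ Fin r) ℂ) (d : MvPolynomial ((Fin r × Fin r) ⊕ Fin r) ℂ), d ≠ 0 → (∀ i : Fin r, ∑ j : Fin r, MvPolynomial.X (Sum.inl (i, j)) * y j = d * MvPolynomial.X (Sum.inr i)) → Literature.Computability.AlgebraicComplexity.algBorderRank (Literature.Computability.AlgebraicComplexity.matMulTensor ℂ (r / 4) (r / 4) (r / 4)) ≤ 6 * Literature.Computability.AlgebraicComplexity.complexity d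

/-- item stmt-MatrixMultiplication-7718 · assembly · rank 1 · open · by planner
sources: Blaser2013, Andrews2022
[assembly] AndrewsLifting → CheapIdealMember → MatrixMultiplication (Bini bookkeeping). -/
@[route_item "route-MatrixMultiplication-DeterminantalIdealExponent"]
def Assembly : Prop :=
  AndrewsLifting → CheapIdealMember → MatrixMultiplication

/-! D-0027 §2.1 — DECIDING THEOREM (planner-authored via `route open/edit --closes-file`; by planner-rbadge-MatrixMultiplication-Determinan-67fc3d13-g2-0 2026-08-15T16:19:43Z):
its hypotheses are this route's items and its conclusion the sub-problem Statement (glue_lint), and it elaborates with this file. -/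

@[closes "route-MatrixMultiplication-DeterminantalIdealExponent"] theorem closes (hL : AndrewsLifting) (hX : CheapIdealMember) : MatrixMultiplication := by
  -- D-0027 §2.1 deciding theorem (Bini bookkeeping; Blaser2013 Thm 6.6 is PROVED in tree as
  -- `Blaser2013_thm66_holds`). For ε > 0: CheapIdealMember at ε/2 holds frequently in r, so pick
  -- r ≥ 4⌈A^(2/ε)⌉ + 8 (A := 6·8^(2+ε/2)) and g ≠ 0 with complexity(g·det_r) ≤ r^(2+ε/2);
  -- AndrewsLifting gives bR(⟨q,q,q⟩) ≤ ρ := max (6·complexity(g·det_r)) 1 with q = ⌊r/4⌋ ≥ 2, and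
  -- r ≤ 8q gives ρ ≤ A·q^(2+ε/2) ≤ q^(ε/2)·q^(2+ε/2) = q^(2+ε); Bini (cubic form) then yields
  -- ω(ℂ) ≤ log_q ρ ≤ log_q q^(2+ε) = 2 + ε. Hence ω(ℂ) ≤ 2, and ω(ℂ) ≥ 2 is `omega_two_le`.
  rw [MatrixMultiplication_iff]
  refine le_antisymm ?_ (Literature.Computability.AlgebraicComplexity.omega_two_le ℂ)
  refine le_of_forall_pos_le_add fun ε hε => ?_
  have hε2 : (0 : ℝ) < ε / 2 := by positivity
  have hA0 : (0 : ℝ) < 6 * (8 : ℝ) ^ (2 + ε / 2) := by positivity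
  obtain ⟨r, ⟨g, hg, hc⟩, hr⟩ := ((hX (ε / 2) hε2).and_eventually
    (Filter.eventually_ge_atTop (4 * ⌈(6 * (8 : ℝ) ^ (2 + ε / 2)) ^ (2 / ε)⌉₊ + 8))).exists
  have hq2 : 2 ≤ r / 4 := by omega
  have hqN : ⌈(6 * (8 : ℝ) ^ (2 + ε / 2)) ^ (2 / ε)⌉₊ ≤ r / 4 := by omega
  have hr8 : r ≤ 8 * (r / 4) := by omega
  have hq1 : (1 : ℝ) < ((r / 4 : ℕ) : ℝ) := by exact_mod_cast (by omega : 1 < r / 4)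
  have hq0 : (0 : ℝ) < ((r / 4 : ℕ) : ℝ) := by positivity
  have hr8' : (r : ℝ) ≤ 8 * ((r / 4 : ℕ) : ℝ) := by exact_mod_cast hr8
  -- Bini's theorem (Blaser2013 Thm 6.6, cubic form) at q = ⌊r/4⌋ and ρ = max (6·complexity) 1
  have hρ1 : 1 ≤ max (6 * Literature.Computability.AlgebraicComplexity.complexity
      (g * Literature.Computability.AlgebraicComplexity.detPoly (Fin r) ℂ)) 1 := le_max_right _ _
  have hbr : Literature.Computability.AlgebraicComplexity.algBorderRank
      (Literature.Computability.AlgebraicComplexity.matMulTensor ℂ (r / 4) (r / 4) (r / 4)) ≤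
      max (6 * Literature.Computability.AlgebraicComplexity.complexity
        (g * Literature.Computability.AlgebraicComplexity.detPoly (Fin r) ℂ)) 1 :=
    (hL r g hg).trans (le_max_left _ _)
  have hω :=
    Literature.Computability.AlgebraicComplexity.Blaser2013_thm66_holds.cubic ℂ hq2 hρ1 hbr
  -- the arithmetic ρ ≤ q^(2+ε)
  have hAq : 6 * (8 : ℝ) ^ (2 + ε / 2) ≤ ((r / 4 : ℕ) : ℝ) ^ (ε / 2) := by
    have hN : (6 * (8 : ℝ) ^ (2 + ε / 2)) ^ (2 / ε) ≤ ((r / 4 : ℕ) : ℝ) :=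
      (Nat.le_ceil _).trans (by exact_mod_cast hqN)
    have h1 : ((6 * (8 : ℝ) ^ (2 + ε / 2)) ^ (2 / ε)) ^ (ε / 2) ≤ ((r / 4 : ℕ) : ℝ) ^ (ε / 2) :=
      Real.rpow_le_rpow (by positivity) hN hε2.le
    have h2 : ((6 * (8 : ℝ) ^ (2 + ε / 2)) ^ (2 / ε)) ^ (ε / 2) = 6 * (8 : ℝ) ^ (2 + ε / 2) := by
      rw [← Real.rpow_mul hA0.le]
      have : 2 / ε * (ε / 2) = 1 := by field_simp
      rw [this, Real.rpow_one]
    rwa [h2] at h1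
  have hsplit : ((r / 4 : ℕ) : ℝ) ^ (2 + ε) =
      ((r / 4 : ℕ) : ℝ) ^ (ε / 2) * ((r / 4 : ℕ) : ℝ) ^ (2 + ε / 2) := by
    rw [← Real.rpow_add hq0]; congr 1; ring
  have hc6 : ((6 * Literature.Computability.AlgebraicComplexity.complexity
      (g * Literature.Computability.AlgebraicComplexity.detPoly (Fin r) ℂ) : ℕ) : ℝ) ≤
      6 * (8 : ℝ) ^ (2 + ε / 2) * ((r / 4 : ℕ) : ℝ) ^ (2 + ε / 2) := by
    push_cast
    calc (6 : ℝ) * (Literature.Computability.AlgebraicComplexity.complexity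
          (g * Literature.Computability.AlgebraicComplexity.detPoly (Fin r) ℂ) : ℝ)
          ≤ 6 * (r : ℝ) ^ (2 + ε / 2) := mul_le_mul_of_nonneg_left hc (by norm_num)
      _ ≤ 6 * ((8 : ℝ) * ((r / 4 : ℕ) : ℝ)) ^ (2 + ε / 2) :=
          mul_le_mul_of_nonneg_left (Real.rpow_le_rpow (Nat.cast_nonneg r) hr8' (by positivity))
            (by norm_num)
      _ = 6 * (8 : ℝ) ^ (2 + ε / 2) * ((r / 4 : ℕ) : ℝ) ^ (2 + ε / 2) := by
          rw [Real.mul_rpow (by norm_num) hq0.le]; ring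
  have hone : (1 : ℝ) ≤ 6 * (8 : ℝ) ^ (2 + ε / 2) * ((r / 4 : ℕ) : ℝ) ^ (2 + ε / 2) := by
    have h8 : (1 : ℝ) ≤ (8 : ℝ) ^ (2 + ε / 2) := Real.one_le_rpow (by norm_num) (by positivity)
    have h1 : (1 : ℝ) ≤ ((r / 4 : ℕ) : ℝ) ^ (2 + ε / 2) := Real.one_le_rpow hq1.le (by positivity)
    nlinarith
  have hρA : ((max (6 * Literature.Computability.AlgebraicComplexity.complexity
      (g * Literature.Computability.AlgebraicComplexity.detPoly (Fin r) ℂ)) 1 : ℕ) : ℝ) ≤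
      6 * (8 : ℝ) ^ (2 + ε / 2) * ((r / 4 : ℕ) : ℝ) ^ (2 + ε / 2) := by
    rcases le_total (6 * Literature.Computability.AlgebraicComplexity.complexity
        (g * Literature.Computability.AlgebraicComplexity.detPoly (Fin r) ℂ)) 1 with h | h
    · rw [max_eq_right h]; simpa using hone
    · rw [max_eq_left h]; exact hc6
  have hρle : ((max (6 * Literature.Computability.AlgebraicComplexity.complexity
      (g * Literature.Computability.AlgebraicComplexity.detPoly (Fin r) ℂ)) 1 : ℕ) : ℝ) ≤
      ((r / 4 : ℕ) : ℝ) ^ (2 + ε) := by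
    calc _ ≤ 6 * (8 : ℝ) ^ (2 + ε / 2) * ((r / 4 : ℕ) : ℝ) ^ (2 + ε / 2) := hρA
      _ ≤ ((r / 4 : ℕ) : ℝ) ^ (ε / 2) * ((r / 4 : ℕ) : ℝ) ^ (2 + ε / 2) :=
          mul_le_mul_of_nonneg_right hAq (by positivity)
      _ = ((r / 4 : ℕ) : ℝ) ^ (2 + ε) := hsplit.symm
  have hρpos : (0 : ℝ) < ((max (6 * Literature.Computability.AlgebraicComplexity.complexity
      (g * Literature.Computability.AlgebraicComplexity.detPoly (Fin r) ℂ)) 1 : ℕ) : ℝ) := by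
    exact_mod_cast hρ1
  calc Literature.Computability.AlgebraicComplexity.omega ℂ ≤ _ := hω
    _ ≤ Real.logb ((r / 4 : ℕ) : ℝ) (((r / 4 : ℕ) : ℝ) ^ (2 + ε)) :=
        Real.logb_le_logb_of_le hq1 hρpos hρle
    _ = 2 + ε := Real.logb_rpow hq0 hq1.ne'

end Summit.MatrixMultiplication.MatrixMultiplication.Theses.DeterminantalIdealExponent
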